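import Summits.QuantumFields.YangMills.Theorems.BalabanUVNodesN19SharpPrice
import Literature.NumberTheory.LFunctions.DeBruijnNewmanProofs

/-!
# YM-DAG node N19 (= NE7 proper) — THE TILTED PRICE, module 1∕3: the two entire GAUGES (shifted sine for an interior source, cosine for
# the window's edge) and the all-order disc ∕ diameter two-constants Cauchy estimate [folklore complex analysis]

Cell `pub-ymgap`, HUMAN RULING D-0062 (Track A), R141 (C) wider-strategy seat `pub-ymgap-dag-n19-e` (strategy s3 = ALTERNATIVE CURRENCY), generation
g15, module 1 of 3 (siblings: `…N19TiltedPrice` — probability ∕ tilted-mean faces; `…N19TiltedPriceTwoSided` — the grid-Chebyshev pair read at the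
window's edge).  Route `Summits/QuantumFields/YangMills/Theses/BalabanUVNodes.lean` rev 21, cluster item K3⁵ «SpineGivenEndpointR13SepCoP»
(stmt-QuantumFields-20296); filed `--supports` that item `--as helper` (it proves no registered stub).  COUNT-NEUTRAL: elementary complex analysis over
Mathlib (Cauchy's estimate of every order, `Real.arcsin`) + the tree's `Literature.Analysis.Complex.TwoConstantsDisc` BY NAME (through p480837
`…N19ExpectationCurrencyTwoConstants`: `norm_deriv_le_linlog`, `twoConstants_exponent_le_two_mul`) + the tree's `‖sin w‖, ‖cos w‖ ≤ e^{|Im w|}`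
(`Literature.NumberTheory.LFunctions.norm_sin∕cos_le_exp_abs_im`, imported — the gate's dedup forbids a copy); NOT a discharge claim.

THE «DEGREE CURRENCY».  Window data of a `[−B, B]`-bounded observable — cgf's `ε`-close on the real segment `|t| ≤ l₀` — behaves like a polynomial of
degree `n ≍ log ε⁻¹ ∕ log log ε⁻¹`: the mean (derivative AT THE CENTRE) costs `ε·n` (p516009 ∕ p517472), the value OFF the window costs Chebyshev growth
`T_n` (p521610 ∕ p524926).  THIS GENERATION: the derivative at an INTERIOR source `s` costs Bernstein's `ε·n ∕ √(1 − (s∕l₀)²)`, and AT THE EDGE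
`s = ±l₀` Markov's `ε·n²` (two-sided at the edge, module 3).  This module is the complex-variable engine:
§1 `f` entire, `‖f‖ ≤ M` on `‖z‖ ≤ R`, `‖f x‖ ≤ m` on the real diameter ⇒ `‖f⁽ⁿ⁾(0)‖ ≤ n!·m^{1−λ(r)}M^{λ(r)}∕(rR)ⁿ` (the tree's disc ∕ diameter
two-constants theorem on `‖z‖ ≤ rR` + Cauchy of order `n`) and `≤ n!·m·(2e·max(1, log⁺(M∕m)∕n)∕R)ⁿ` (radius `½` or `n∕(2 log(M∕m))`).
§2 INTERIOR = Bernstein: `‖f‖ ≤ M` on `‖z‖ ≤ |a+b|∕2 + ((b−a)∕2)e^{Kρ}`, `‖f x‖ ≤ m` on `[a, b] ∋ 0` ⇒ `‖f′(0)‖ ≤ 2e·m·(1 + log⁺(M∕m))∕(ρ·K·√(−ab))`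
by the SHIFTED sine gauge `φ(w) = c₀ + h·sin(Kw + w₀)` (`c₀ = (a+b)∕2`, `h = (b−a)∕2`, `w₀ = arcsin(−c₀∕h)`: `φ(ℝ) ⊆ [a, b]`, `φ(0) = 0`,
`‖φ(w)‖ ≤ |c₀| + h·e^{K|Im w|}`, `φ′(0) = K√(−ab)`) fed to p480837's disc ∕ diameter lemma; at `[−l₀−s, l₀−s]` the factor is `1∕√(l₀² − s²)`.
§3 EDGE = Markov: `‖f‖ ≤ M` on `‖z‖ ≤ (|a|∕2)(1 + e^{Kρ})`, `‖f x‖ ≤ m` on `[a, 0]` ⇒ `‖f′(0)‖ ≤ 16e²·m·max(1, log⁺(M∕m)∕2)²∕(ρ²·|a|·K²)` by the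
COSINE gauge `φ(w) = (|a|∕2)(cos(Kw) − 1)` (`φ′(0) = 0`, `φ″(0) = −(|a|∕2)K²`, so `(f ∘ φ)″(0) = −(|a|∕2)K²·f′(0)`: §1 at order `2` — the SQUARE of
the logarithm); mirror for `[0, b]`.

KERNEL-CHECKED (0 `def`, 0 `sorry`): §1 `norm_iteratedDeriv_le_two_constants`, `norm_iteratedDeriv_le_linlog` · §2 ★ `norm_deriv_le_linlog_of_segment` ·
§3 ★ `norm_deriv_le_sqlog_of_segment_end`, ★ `norm_deriv_le_sqlog_of_segment_start`.
NOT claimed: optimal constants; higher derivatives through the gauges (Faà di Bruno — no consumer).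

HONEST FRAMING (binding).  Elementary complex analysis [folklore]; NO consumer in the DAG today (the siblings' tilted-mean theorems sharpen p497552's
`1∕(l₀ − l₁)` to Bernstein's `1∕√(l₀² − s²)` with the `log log`, and price the edge; N14's `TiltedMeanMatching` binder needs SOME `l₁ < l₀`, already
served).  Nothing of [Balaban1987RG1]–[Balaban1989LargeFieldII] or [King1986] is asserted, quoted or instantiated; NE7 ∕ NE7b ∕ NE7c NOT PRINTED, NOT
proved; N19 NOT discharged; Track A count unmoved (typed 28∕28 · discharged 5∕27 · A 5∕28).  One finite `T⁴` programme at fixed `ε`; nothing continuum ∕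
`ℝ⁴` ∕ OS ∕ mass-gap ∕ Clay.  THEOREMS ONLY; standard axioms; no cite tags (the two-constants theorem is the tree's, used by name).
-/

set_option autoImplicit false

noncomputable section

open Set Metric Filter Topology Complex

namespace Summit.QuantumFields.YangMills.Theorems.BalabanUVNodesN19TiltedPriceGauges

open Literature.Analysis.Complex.TwoConstantsDisc (norm_le_two_constants_disc_of_norm_le)
open Literature.NumberTheory.LFunctions (norm_sin_le_exp_abs_im norm_cos_le_exp_abs_im)
open Summit.QuantumFields.YangMills.BalabanUVNodes.N19ExpectationCurrencyTwoConstants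
  (norm_deriv_le_linlog twoConstants_exponent_le_two_mul)

variable {E : Type*} [NormedAddCommGroup E] [NormedSpace ℂ E]

/-! ## §1 All orders on the disc: two constants (disc ∕ diameter) + Cauchy's estimate of order `n` [folklore] -/

section Disc

variable [CompleteSpace E]

/-- **`n`-th derivative at the centre from two constants, r-form.**  `f` entire, `‖f z‖ ≤ M` on `‖z‖ ≤ R`, `‖f x‖ ≤ m` for real `|x| < R`
(`0 ≤ m ≤ M`); then for every `0 < r < 1`: `‖f⁽ⁿ⁾(0)‖ ≤ n!·m^{1−λ(r)}·M^{λ(r)}∕(rR)ⁿ`, `λ(r) = (2∕π)·arctan(2r∕(1−r²))` — the tree's two-constants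
theorem (disc ∕ diameter) bounds `f(R·)` on the circle `‖w‖ = r`, then Cauchy's estimate of order `n`. [folklore] -/
theorem norm_iteratedDeriv_le_two_constants {f : ℂ → E} {m M R r : ℝ} (n : ℕ) (hR : 0 < R) (hf : Differentiable ℂ f)
    (hM : ∀ z : ℂ, ‖z‖ ≤ R → ‖f z‖ ≤ M) (hm : ∀ x : ℝ, |x| < R → ‖f x‖ ≤ m) (hm0 : 0 ≤ m) (hmM : m ≤ M)
    (hr0 : 0 < r) (hr1 : r < 1) :
    ‖iteratedDeriv n f 0‖ ≤ n.factorial * (m ^ (1 - 2 / Real.pi * Real.arctan (2 * r / (1 - r ^ 2))) *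
      M ^ (2 / Real.pi * Real.arctan (2 * r / (1 - r ^ 2)))) / (r * R) ^ n := by
  set l : ℝ := 2 / Real.pi * Real.arctan (2 * r / (1 - r ^ 2)) with hl
  set g : ℂ → E := fun z => f ((R : ℂ) * z) with hg
  have hRn : ∀ z : ℂ, ‖(R : ℂ) * z‖ = R * ‖z‖ := fun z => by
    rw [norm_mul, Complex.norm_real, Real.norm_eq_abs, abs_of_pos hR]
  have hgd : Differentiable ℂ g := hf.comp (differentiable_id.const_mul (R : ℂ))
  have hMg : ∀ z : ℂ, ‖z‖ ≤ 1 → ‖g z‖ ≤ M := fun z hz =>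
    hM _ (by rw [hRn]; nlinarith)
  have hmg : ∀ x : ℝ, |x| < 1 → ‖g x‖ ≤ m := fun x hx => by
    have e : (R : ℂ) * (x : ℂ) = ((R * x : ℝ) : ℂ) := by push_cast; ring
    show ‖f ((R : ℂ) * (x : ℂ))‖ ≤ m
    rw [e]
    refine hm (R * x) ?_
    rw [abs_mul, abs_of_pos hR]
    nlinarith
  -- two constants on `‖z‖ ≤ r`, then Cauchy's estimate of order `n` on the circle `‖z‖ = r`
  have hC : ∀ z ∈ sphere (0 : ℂ) r, ‖g z‖ ≤ m ^ (1 - l) * M ^ l := fun z hz =>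
    norm_le_two_constants_disc_of_norm_le hgd.diffContOnCl hMg hmg hm0 hmM hr1 (mem_sphere_zero_iff_norm.1 hz).le
  have key := Complex.norm_iteratedDeriv_le_of_forall_mem_sphere_norm_le n hr0 hgd.diffContOnCl hC
  -- `g⁽ⁿ⁾(0) = Rⁿ • f⁽ⁿ⁾(0)`
  have hderiv : iteratedDeriv n g 0 = (R : ℂ) ^ n • iteratedDeriv n f 0 := by
    have h := congrFun (iteratedDeriv_comp_const_smul (hf.contDiff (n := n)) (R : ℂ)) 0
    rw [mul_zero] at h
    exact h
  rw [hderiv, norm_smul, norm_pow, Complex.norm_real, Real.norm_eq_abs, abs_of_pos hR] at key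
  rw [le_div_iff₀ (by positivity), mul_pow]
  calc ‖iteratedDeriv n f 0‖ * (r ^ n * R ^ n) = R ^ n * ‖iteratedDeriv n f 0‖ * r ^ n := by ring
    _ ≤ n.factorial * (m ^ (1 - l) * M ^ l) / r ^ n * r ^ n :=
        mul_le_mul_of_nonneg_right key (pow_nonneg hr0.le n)
    _ = n.factorial * (m ^ (1 - l) * M ^ l) := div_mul_cancel₀ _ (pow_ne_zero n hr0.ne')

/-- **`n`-th derivative at the centre from two constants, LINEAR-LOG form** (`1 ≤ n`, `0 ≤ m`): `f` entire, `‖f‖ ≤ M` on `‖z‖ ≤ R`, `‖f x‖ ≤ m`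
on the real diameter ⇒ `‖f⁽ⁿ⁾(0)‖ ≤ n!·m·(2e·max(1, log⁺(M∕m)∕n)∕R)ⁿ`.  Radius in the r-form: `r = ½` if `Λ := log(max(M,m)∕m) ≤ n` (then
`(M∕m)^{λ} ≤ e^{Λ} ≤ eⁿ`), else `r = n∕(2Λ)` (then `λ(r) ≤ 2r = n∕Λ`, `(M∕m)^{n∕Λ} = eⁿ`). [folklore] -/
theorem norm_iteratedDeriv_le_linlog {f : ℂ → E} {m M R : ℝ} {n : ℕ} (hn : 1 ≤ n) (hR : 0 < R) (hf : Differentiable ℂ f)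
    (hM : ∀ z : ℂ, ‖z‖ ≤ R → ‖f z‖ ≤ M) (hm : ∀ x : ℝ, |x| < R → ‖f x‖ ≤ m) (hm0 : 0 ≤ m) :
    ‖iteratedDeriv n f 0‖ ≤
      n.factorial * m * (2 * Real.exp 1 * max 1 (Real.posLog (M / m) / n) / R) ^ n := by
  have hnr : (0 : ℝ) < n := by exact_mod_cast hn
  -- replace `M` by `M' = max M m ≥ m`
  set M' := max M m with hM'
  have hM'' : ∀ z : ℂ, ‖z‖ ≤ R → ‖f z‖ ≤ M' := fun z hz => (hM z hz).trans (le_max_left _ _)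
  have hmM' : m ≤ M' := le_max_right _ _
  -- the r-form, rewritten as `n!·m·(M'/m)^{λ(r)}/(rR)ⁿ` with `λ(r) ≤ 2r`
  have main : ∀ r : ℝ, 0 < r → r ≤ 1 / 2 →
      ‖iteratedDeriv n f 0‖ ≤ n.factorial * (m * (M' / m) ^ (2 * r)) / (r * R) ^ n := by
    intro r hr0 hr
    have h := norm_iteratedDeriv_le_two_constants n hR hf hM'' hm hm0 hmM' hr0 (by linarith)
    set l := 2 / Real.pi * Real.arctan (2 * r / (1 - r ^ 2)) with hl
    have hl1 : l < 1 := by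
      have := Real.arctan_lt_pi_div_two (2 * r / (1 - r ^ 2))
      rw [hl, div_mul_eq_mul_div, div_lt_one Real.pi_pos]
      linarith
    have hl2 : l ≤ 2 * r := twoConstants_exponent_le_two_mul hr0.le hr
    refine h.trans ?_
    rcases hm0.eq_or_lt with hm00 | hmpos
    · rw [← hm00, Real.zero_rpow (by linarith), zero_mul, zero_mul]
    · have hMpos : 0 < M' := hmpos.trans_le hmM'
      have hq : 1 ≤ M' / m := by rwa [le_div_iff₀ hmpos, one_mul]
      have e : m ^ (1 - l) * M' ^ l = m * (M' / m) ^ l := by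
        rw [Real.div_rpow hMpos.le hmpos.le, Real.rpow_sub hmpos, Real.rpow_one]
        field_simp
      rw [e]
      gcongr
  rcases hm0.eq_or_lt with hm00 | hmpos
  · -- `m = 0`
    have h := main (1 / 2) (by norm_num) le_rfl
    rw [← hm00, zero_mul, mul_zero, zero_div] at h
    rw [← hm00, mul_zero, zero_mul]
    exact h
  have hMpos : 0 < M' := hmpos.trans_le hmM'
  have hq : 1 ≤ M' / m := by rwa [le_div_iff₀ hmpos, one_mul]
  set Λ := Real.log (M' / m) with hΛ
  have hΛ0 : 0 ≤ Λ := Real.log_nonneg hq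
  have hexpΛ : Real.exp Λ = M' / m := Real.exp_log (by positivity)
  -- `log⁺(M/m) = Λ`
  have hposLog : Real.posLog (M / m) = Λ := by
    have hM0 : 0 ≤ M := (norm_nonneg (f 0)).trans (hM 0 (by simpa using hR.le))
    have e : M' / m = max 1 (M / m) := by
      rw [hM', ← max_div_div_right hmpos.le, div_self hmpos.ne', max_comm]
    rw [hΛ, e, Real.posLog_eq_log_max_one (div_nonneg hM0 hmpos.le)]
  rw [hposLog]
  have he : 0 < Real.exp 1 := Real.exp_pos 1
  rcases le_or_gt Λ n with hΛn | hΛn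
  · -- `r = ½`
    have h := main (1 / 2) (by norm_num) le_rfl
    have hpow : (M' / m) ^ (2 * (1 / 2 : ℝ)) ≤ Real.exp 1 ^ n :=
      calc (M' / m) ^ (2 * (1 / 2 : ℝ)) = Real.exp Λ := by rw [show 2 * (1 / 2 : ℝ) = 1 by norm_num, Real.rpow_one, hexpΛ]
        _ ≤ Real.exp (n : ℝ) := Real.exp_le_exp.2 hΛn
        _ = Real.exp 1 ^ n := by rw [← Real.exp_one_pow]
    have hmax : (1 : ℝ) ≤ max 1 (Λ / n) := le_max_left _ _
    calc ‖iteratedDeriv n f 0‖ ≤ n.factorial * (m * (M' / m) ^ (2 * (1 / 2 : ℝ))) / (1 / 2 * R) ^ n := h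
      _ ≤ n.factorial * (m * Real.exp 1 ^ n) / (1 / 2 * R) ^ n := by gcongr
      _ = n.factorial * m * (2 * Real.exp 1 * 1 / R) ^ n := by
          rw [div_pow, mul_pow, div_pow, mul_pow]
          field_simp
          ring
      _ ≤ n.factorial * m * (2 * Real.exp 1 * max 1 (Λ / n) / R) ^ n := by gcongr
  · -- `r = n/(2Λ)`
    have hΛpos : 0 < Λ := hnr.trans hΛn
    have hr0 : 0 < n / (2 * Λ) := by positivity
    have hr : n / (2 * Λ) ≤ 1 / 2 := by
      rw [div_le_div_iff₀ (by positivity) (by norm_num)]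
      linarith
    have h := main (n / (2 * Λ)) hr0 hr
    have hpow : (M' / m) ^ (2 * (n / (2 * Λ) : ℝ)) = Real.exp 1 ^ n := by
      rw [show 2 * (n / (2 * Λ) : ℝ) = n / Λ by field_simp, ← hexpΛ, ← Real.exp_mul, mul_div_cancel₀ _ hΛpos.ne',
        Real.exp_one_pow]
    have hmax : Λ / n ≤ max 1 (Λ / n) := le_max_right _ _
    calc ‖iteratedDeriv n f 0‖ ≤ n.factorial * (m * (M' / m) ^ (2 * (n / (2 * Λ) : ℝ))) / (n / (2 * Λ) * R) ^ n := h
      _ = n.factorial * m * (2 * Real.exp 1 * (Λ / n) / R) ^ n := by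
          have e1 : 2 * Real.exp 1 * (Λ / n) / R = Real.exp 1 / (n / (2 * Λ) * R) := by
            field_simp [hΛpos.ne', hnr.ne', hR.ne']
          rw [hpow, e1, div_pow]
          ring
      _ ≤ n.factorial * m * (2 * Real.exp 1 * max 1 (Λ / n) / R) ^ n := by gcongr

end Disc

/-! ## §2 An interior source: the shifted sine gauge (Bernstein's shape) [folklore] -/

/-- **Derivative at an INTERIOR point of a short real segment (Bernstein's shape).**  `f` entire, `‖f z‖ ≤ M` on the disc
`‖z‖ ≤ |a+b|∕2 + ((b−a)∕2)·e^{Kρ}`, `‖f x‖ ≤ m` for real `a ≤ x ≤ b` where `a < 0 < b` (`0 ≤ m`; `0 < K, ρ`); then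
`‖f′(0)‖ ≤ 2e·m·(1 + log⁺(M∕m))∕(ρ·K·√(−ab))` — p480837's disc ∕ diameter lemma on `‖w‖ ≤ ρ` for `f ∘ φ`, `φ(w) = c₀ + h·sin(Kw + w₀)` the
SHIFTED sine gauge (`φ(ℝ) ⊆ [a, b]`, `φ(0) = 0`, `‖φ(w)‖ ≤ |c₀| + h·e^{K|Im w|}`, `φ′(0) = hK·cos w₀ = K·√(−ab)`). [folklore] -/
theorem norm_deriv_le_linlog_of_segment {f : ℂ → E} {m M a b K ρ : ℝ} (ha : a < 0) (hb : 0 < b) (hK : 0 < K) (hρ : 0 < ρ)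
    (hf : Differentiable ℂ f) (hM : ∀ z : ℂ, ‖z‖ ≤ |a + b| / 2 + (b - a) / 2 * Real.exp (K * ρ) → ‖f z‖ ≤ M)
    (hm : ∀ x : ℝ, a ≤ x → x ≤ b → ‖f x‖ ≤ m) (hm0 : 0 ≤ m) :
    ‖deriv f 0‖ ≤ 2 * Real.exp 1 * m * (1 + Real.posLog (M / m)) / (ρ * K * Real.sqrt (-(a * b))) := by
  -- centre, half-length, phase
  set c₀ : ℝ := (a + b) / 2 with hc₀
  set h : ℝ := (b - a) / 2 with hh
  have hh0 : 0 < h := by rw [hh]; linarith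
  set x₀ : ℝ := -c₀ / h with hx₀
  have hx₀1 : -1 ≤ x₀ := by rw [hx₀, le_div_iff₀ hh0, hc₀, hh]; linarith
  have hx₀2 : x₀ ≤ 1 := by rw [hx₀, div_le_iff₀ hh0, hc₀, hh]; linarith
  set w₀ : ℝ := Real.arcsin x₀ with hw₀
  have hsin : Real.sin w₀ = x₀ := Real.sin_arcsin hx₀1 hx₀2
  have hcos : Real.cos w₀ = Real.sqrt (1 - x₀ ^ 2) := Real.cos_arcsin x₀
  have hab : -(a * b) = h ^ 2 - c₀ ^ 2 := by rw [hh, hc₀]; ring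
  have hhcos : h * Real.cos w₀ = Real.sqrt (-(a * b)) := by
    rw [hcos, ← Real.sqrt_sq hh0.le, ← Real.sqrt_mul (sq_nonneg h), hab]
    congr 1
    rw [hx₀]
    field_simp
  have hsqrt0 : 0 < Real.sqrt (-(a * b)) := Real.sqrt_pos.2 (by nlinarith)
  set φ : ℂ → ℂ := fun w => (c₀ : ℂ) + (h : ℂ) * Complex.sin ((K : ℂ) * w + (w₀ : ℂ)) with hφ
  have hφd : Differentiable ℂ φ :=
    ((Complex.differentiable_sin.comp ((differentiable_id.const_mul (K : ℂ)).add_const (w₀ : ℂ))).const_mul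
      (h : ℂ)).const_add (c₀ : ℂ)
  have hφx : ∀ x : ℝ, φ x = ((c₀ + h * Real.sin (K * x + w₀) : ℝ) : ℂ) := fun x => by
    simp only [hφ]
    push_cast
    rfl
  have hφ0 : φ 0 = 0 := by
    have e := hφx 0
    rw [Complex.ofReal_zero] at e
    rw [e, mul_zero, zero_add, hsin, hx₀, mul_div_cancel₀ _ hh0.ne', add_neg_cancel, Complex.ofReal_zero]
  have hφM : ∀ w : ℂ, ‖w‖ ≤ ρ → ‖φ w‖ ≤ |a + b| / 2 + (b - a) / 2 * Real.exp (K * ρ) := fun w hw => by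
    simp only [hφ]
    refine (norm_add_le _ _).trans (add_le_add ?_ ?_)
    · rw [Complex.norm_real, Real.norm_eq_abs, hc₀, abs_div, abs_two]
    · rw [norm_mul, Complex.norm_real, Real.norm_eq_abs, abs_of_pos hh0, hh]
      refine mul_le_mul_of_nonneg_left ((norm_sin_le_exp_abs_im _).trans (Real.exp_le_exp.2 ?_)) hh0.le
      rw [Complex.add_im, Complex.mul_im, Complex.ofReal_re, Complex.ofReal_im, Complex.ofReal_im, zero_mul, add_zero,
        add_zero, abs_mul, abs_of_pos hK]
      exact mul_le_mul_of_nonneg_left ((Complex.abs_im_le_norm w).trans hw) hK.le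
  have hφreal : ∀ x : ℝ, a ≤ c₀ + h * Real.sin (K * x + w₀) ∧ c₀ + h * Real.sin (K * x + w₀) ≤ b := fun x => by
    have h1 := Real.neg_one_le_sin (K * x + w₀)
    have h2 := Real.sin_le_one (K * x + w₀)
    constructor
    · rw [hc₀, hh]; nlinarith
    · rw [hc₀, hh]; nlinarith
  -- the composite and its two constants
  have hg : Differentiable ℂ (f ∘ φ) := hf.comp hφd
  have hMg : ∀ w : ℂ, ‖w‖ ≤ ρ → ‖(f ∘ φ) w‖ ≤ M := fun w hw => hM _ (hφM w hw)
  have hmg : ∀ x : ℝ, |x| < ρ → ‖(f ∘ φ) x‖ ≤ m := fun x _ => by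
    show ‖f (φ x)‖ ≤ m
    rw [hφx]
    exact hm _ (hφreal x).1 (hφreal x).2
  have key := norm_deriv_le_linlog hρ hg.diffContOnCl hMg hmg hm0
  -- the chain rule at `0`: `(f ∘ φ)′(0) = (K√(−ab)) • f′(0)`
  have h1 : HasDerivAt (fun w : ℂ => (K : ℂ) * w + (w₀ : ℂ)) (K : ℂ) 0 := by
    simpa using ((hasDerivAt_id (0 : ℂ)).const_mul (K : ℂ)).add_const (w₀ : ℂ)
  have h2 : HasDerivAt (fun w : ℂ => Complex.sin ((K : ℂ) * w + (w₀ : ℂ)))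
      (Complex.cos ((K : ℂ) * 0 + (w₀ : ℂ)) * (K : ℂ)) 0 := (Complex.hasDerivAt_sin _).comp 0 h1
  have h3 : HasDerivAt φ ((h : ℂ) * (Complex.cos ((K : ℂ) * 0 + (w₀ : ℂ)) * (K : ℂ))) 0 :=
    (h2.const_mul (h : ℂ)).const_add (c₀ : ℂ)
  rw [mul_zero, zero_add, ← Complex.ofReal_cos] at h3
  have hcoef : (h : ℂ) * ((Real.cos w₀ : ℂ) * (K : ℂ)) = ((K * Real.sqrt (-(a * b)) : ℝ) : ℂ) := by
    rw [← hhcos]; push_cast; ring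
  rw [hcoef] at h3
  have hcomp : HasDerivAt (f ∘ φ) (((K * Real.sqrt (-(a * b)) : ℝ) : ℂ) • deriv f (φ 0)) 0 :=
    (hf (φ 0)).hasDerivAt.scomp 0 h3
  rw [hφ0] at hcomp
  rw [hcomp.deriv, norm_smul, Complex.norm_real, Real.norm_eq_abs, abs_of_pos (mul_pos hK hsqrt0)] at key
  rw [le_div_iff₀ (by positivity)]
  calc ‖deriv f 0‖ * (ρ * K * Real.sqrt (-(a * b))) = K * Real.sqrt (-(a * b)) * ‖deriv f 0‖ * ρ := by ring
    _ ≤ 2 * Real.exp 1 * m * (1 + Real.posLog (M / m)) / ρ * ρ := mul_le_mul_of_nonneg_right key hρ.le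
    _ = 2 * Real.exp 1 * m * (1 + Real.posLog (M / m)) := div_mul_cancel₀ _ hρ.ne'

/-! ## §3 The edge: the cosine gauge and the second-order estimate (Markov's shape) [folklore] -/

section Edge

variable [CompleteSpace E]

/-- **Derivative at the END of a short real segment (Markov's shape).**  `f` entire, `‖f z‖ ≤ M` on the disc `‖z‖ ≤ (|a|∕2)·(1 + e^{Kρ})`,
`‖f x‖ ≤ m` for real `a ≤ x ≤ 0` where `a < 0` (`0 ≤ m`; `0 < K, ρ`); then `‖f′(0)‖ ≤ 16e²·m·max(1, log⁺(M∕m)∕2)²∕(ρ²·|a|·K²)` — the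
COSINE gauge `φ(w) = (|a|∕2)·(cos(Kw) − 1)` (`φ(ℝ) ⊆ [a, 0]`, `φ(0) = 0`, `φ′(0) = 0`, `φ″(0) = −(|a|∕2)K²`): `(f ∘ φ)″(0) = −(|a|∕2)K²·f′(0)`
and §1's estimate of order `2` for `f ∘ φ` on `‖w‖ ≤ ρ` is divided by `(|a|∕2)K²`. [folklore] -/
theorem norm_deriv_le_sqlog_of_segment_end {f : ℂ → E} {m M a K ρ : ℝ} (ha : a < 0) (hK : 0 < K) (hρ : 0 < ρ)
    (hf : Differentiable ℂ f) (hM : ∀ z : ℂ, ‖z‖ ≤ |a| / 2 * (1 + Real.exp (K * ρ)) → ‖f z‖ ≤ M)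
    (hm : ∀ x : ℝ, a ≤ x → x ≤ 0 → ‖f x‖ ≤ m) (hm0 : 0 ≤ m) :
    ‖deriv f 0‖ ≤ 16 * Real.exp 2 * m * max 1 (Real.posLog (M / m) / 2) ^ 2 / (ρ ^ 2 * |a| * K ^ 2) := by
  set h : ℝ := |a| / 2 with hh
  have hh0 : 0 < h := by rw [hh]; exact div_pos (abs_pos.2 ha.ne) two_pos
  have hha : a = -(2 * h) := by rw [hh, abs_of_neg ha]; ring
  set φ : ℂ → ℂ := fun w => (h : ℂ) * (Complex.cos ((K : ℂ) * w) - 1) with hφ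
  have hφd : Differentiable ℂ φ :=
    ((Complex.differentiable_cos.comp (differentiable_id.const_mul (K : ℂ))).sub_const 1).const_mul (h : ℂ)
  have hφx : ∀ x : ℝ, φ x = ((h * (Real.cos (K * x) - 1) : ℝ) : ℂ) := fun x => by
    simp only [hφ]
    push_cast
    rfl
  have hφ0 : φ 0 = 0 := by simp [hφ]
  have hφM : ∀ w : ℂ, ‖w‖ ≤ ρ → ‖φ w‖ ≤ |a| / 2 * (1 + Real.exp (K * ρ)) := fun w hw => by
    simp only [hφ]
    rw [norm_mul, Complex.norm_real, Real.norm_eq_abs, abs_of_pos hh0, hh]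
    refine mul_le_mul_of_nonneg_left ((norm_sub_le _ _).trans ?_) hh0.le
    rw [norm_one, add_comm]
    refine add_le_add le_rfl ((norm_cos_le_exp_abs_im _).trans (Real.exp_le_exp.2 ?_))
    rw [Complex.mul_im, Complex.ofReal_re, Complex.ofReal_im, zero_mul, add_zero, abs_mul, abs_of_pos hK]
    exact mul_le_mul_of_nonneg_left ((Complex.abs_im_le_norm w).trans hw) hK.le
  have hφreal : ∀ x : ℝ, a ≤ h * (Real.cos (K * x) - 1) ∧ h * (Real.cos (K * x) - 1) ≤ 0 := fun x => by
    have h1 := Real.neg_one_le_cos (K * x)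
    have h2 := Real.cos_le_one (K * x)
    constructor
    · rw [hha]; nlinarith
    · nlinarith
  -- the composite and the second-order estimate
  have hg : Differentiable ℂ (f ∘ φ) := hf.comp hφd
  have hMg : ∀ w : ℂ, ‖w‖ ≤ ρ → ‖(f ∘ φ) w‖ ≤ M := fun w hw => hM _ (hφM w hw)
  have hmg : ∀ x : ℝ, |x| < ρ → ‖(f ∘ φ) x‖ ≤ m := fun x _ => by
    show ‖f (φ x)‖ ≤ m
    rw [hφx]
    exact hm _ (hφreal x).1 (hφreal x).2
  have key := norm_iteratedDeriv_le_linlog (n := 2) (by norm_num) hρ hg hMg hmg hm0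
  -- `(f ∘ φ)″(0) = −(hK²) • f′(0)`
  have hφ' : ∀ w : ℂ, HasDerivAt φ ((h : ℂ) * (-Complex.sin ((K : ℂ) * w) * (K : ℂ))) w := fun w => by
    have h1 : HasDerivAt (fun w : ℂ => (K : ℂ) * w) (K : ℂ) w := by
      simpa using (hasDerivAt_id w).const_mul (K : ℂ)
    have h2 : HasDerivAt (fun w : ℂ => Complex.cos ((K : ℂ) * w)) (-Complex.sin ((K : ℂ) * w) * (K : ℂ)) w :=
      (Complex.hasDerivAt_cos _).comp w h1
    exact (h2.sub_const (1 : ℂ)).const_mul (h : ℂ)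
  have hg' : deriv (f ∘ φ) = fun w => ((h : ℂ) * (-Complex.sin ((K : ℂ) * w) * (K : ℂ))) • deriv f (φ w) := by
    funext w
    exact ((hf (φ w)).hasDerivAt.scomp w (hφ' w)).deriv
  -- the scalar factor `ψ(w) = h·(−sin(Kw)·K)` has `ψ(0) = 0`, `ψ′(0) = −hK²`
  have hψ : HasDerivAt (fun w : ℂ => (h : ℂ) * (-Complex.sin ((K : ℂ) * w) * (K : ℂ))) (-((h : ℂ) * (K : ℂ) ^ 2)) 0 := by
    have h1 : HasDerivAt (fun w : ℂ => (K : ℂ) * w) (K : ℂ) 0 := by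
      simpa using (hasDerivAt_id (0 : ℂ)).const_mul (K : ℂ)
    have h2 : HasDerivAt (fun w : ℂ => Complex.sin ((K : ℂ) * w)) (Complex.cos ((K : ℂ) * 0) * (K : ℂ)) 0 :=
      (Complex.hasDerivAt_sin _).comp 0 h1
    rw [mul_zero, Complex.cos_zero, one_mul] at h2
    exact (((h2.neg).mul_const (K : ℂ)).const_mul (h : ℂ)).congr_deriv (by ring)
  have hG : HasDerivAt (fun w : ℂ => deriv f (φ w)) (((h : ℂ) * (-Complex.sin ((K : ℂ) * 0) * (K : ℂ))) • deriv (deriv f) (φ 0)) 0 :=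
    ((hf.deriv (φ 0)).hasDerivAt).scomp 0 (hφ' 0)
  have hprod := hψ.smul hG
  rw [mul_zero, Complex.sin_zero, neg_zero, zero_mul, mul_zero, zero_smul, zero_add, hφ0] at hprod
  have h2d : iteratedDeriv 2 (f ∘ φ) 0 = (-((h : ℂ) * (K : ℂ) ^ 2)) • deriv f 0 := by
    rw [iteratedDeriv_succ, iteratedDeriv_one, hg']
    exact hprod.deriv
  rw [h2d, norm_smul, norm_neg, norm_mul, norm_pow, Complex.norm_real, Complex.norm_real, Real.norm_eq_abs,
    Real.norm_eq_abs, abs_of_pos hh0, abs_of_pos hK] at key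
  -- conclude: `hK²·‖f′(0)‖ ≤ 2·m·(2e·max(1,Λ/2)/ρ)²`
  have hapos : 0 < |a| := abs_pos.2 ha.ne
  rw [le_div_iff₀ (by positivity)]
  have e2 : Real.exp 2 = Real.exp 1 ^ 2 := by rw [Real.exp_one_pow, Nat.cast_ofNat]
  calc ‖deriv f 0‖ * (ρ ^ 2 * |a| * K ^ 2) = 2 * ρ ^ 2 * (h * K ^ 2 * ‖deriv f 0‖) := by rw [hh]; ring
    _ ≤ 2 * ρ ^ 2 * ((2 : ℕ).factorial * m * (2 * Real.exp 1 * max 1 (Real.posLog (M / m) / (2 : ℕ)) / ρ) ^ 2) :=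
        mul_le_mul_of_nonneg_left key (by positivity)
    _ = 16 * Real.exp 2 * m * max 1 (Real.posLog (M / m) / 2) ^ 2 := by
        rw [e2, Nat.factorial_two, Nat.cast_ofNat, div_pow, mul_pow, mul_pow]
        field_simp
        ring

/-- **Derivative at the START of a short real segment** (mirror of the previous lemma through `z ↦ −z`): `f` entire, `‖f z‖ ≤ M` on
`‖z‖ ≤ (b∕2)(1 + e^{Kρ})`, `‖f x‖ ≤ m` for real `0 ≤ x ≤ b` where `0 < b` ⇒ `‖f′(0)‖ ≤ 16e²·m·max(1, log⁺(M∕m)∕2)²∕(ρ²·b·K²)`. [folklore] -/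
theorem norm_deriv_le_sqlog_of_segment_start {f : ℂ → E} {m M b K ρ : ℝ} (hb : 0 < b) (hK : 0 < K) (hρ : 0 < ρ)
    (hf : Differentiable ℂ f) (hM : ∀ z : ℂ, ‖z‖ ≤ b / 2 * (1 + Real.exp (K * ρ)) → ‖f z‖ ≤ M)
    (hm : ∀ x : ℝ, 0 ≤ x → x ≤ b → ‖f x‖ ≤ m) (hm0 : 0 ≤ m) :
    ‖deriv f 0‖ ≤ 16 * Real.exp 2 * m * max 1 (Real.posLog (M / m) / 2) ^ 2 / (ρ ^ 2 * b * K ^ 2) := by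
  have hfn : Differentiable ℂ (fun z : ℂ => f (-z)) := hf.comp differentiable_neg
  have hM' : ∀ z : ℂ, ‖z‖ ≤ |(-b)| / 2 * (1 + Real.exp (K * ρ)) → ‖f (-z)‖ ≤ M := fun z hz => by
    rw [abs_neg, abs_of_pos hb] at hz
    exact hM (-z) (by rwa [norm_neg])
  have hm' : ∀ x : ℝ, -b ≤ x → x ≤ 0 → ‖f (-(x : ℂ))‖ ≤ m := fun x h1 h2 => by
    rw [← Complex.ofReal_neg]
    exact hm (-x) (by linarith) (by linarith)
  have h := norm_deriv_le_sqlog_of_segment_end (f := fun z : ℂ => f (-z)) (neg_lt_zero.2 hb) hK hρ hfn hM' hm' hm0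
  rwa [deriv_comp_neg, neg_zero, norm_neg, abs_neg, abs_of_pos hb] at h

end Edge

end Summit.QuantumFields.YangMills.Theorems.BalabanUVNodesN19TiltedPriceGauges

end
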